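import Summits.QuantumAdvantage.QuantumAdvantage.Theorems.CubicForrelationNearExactIsExactTwentyPairing

/-!
# Crux `CubicForrelation.NearExactIsExact` (stmt-QuantumAdvantage-14043) — n = 20, TWO-SIDED: a type-O cubic never reaches `Φ = 127/128`

Certificate seat `b2b-cforr-cert` (gen 6).  HONEST FRAMING: a theorem about cubic Boolean functions on 20 bits (finite slice `n = 20` of the
crux) — the type-O boundary configuration of the certified bound `θ₂₀ ≤ 127/128` (`theta_twenty_bounds`, the uniform rate at `n = 20`) is
excluded two-sidedly; NOT summit progress.

`tt20_typeO_lt`: for cubic `f, g : 𝔽₂²⁰ → 𝔽₂` with `W_g = 128u` and ALL `u` odd (type O), `Φ(f,g) < 127/128`.  Proof: the budget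
`Σ(u − 8s)² = 2²⁷(1−Φ) ≤ 2²⁰` (`s = (−1)^f`) pays `≥ 1` at every point, so `τ = u − 8s = ±1` EVERYWHERE and `Φ = 127/128`; the general 3- and 4-flat
sums on 20 bits (`fs_flat_sum_dvd`: `4 ∣ Σ₃ u`, `8 ∣ Σ₄ u`; Ax `8Σ(−1)^f ∈ 16ℤ, 32ℤ`) are exactly the hypotheses (H3)/(H4) of the engine
`fl1_flat_l1` with `V₀ = S = 𝔽₂²⁰` (the sign pattern `τ` is quadratic of rank `≤ 2` on the whole space), so `Σ_y |τ̂(y)| ≤ 2²¹`; but the pairing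
identity needs `Σ_y (−1)^{g(y)} τ̂(y) = 2³³(1 − Φ) = 2²⁶` (`tp20_pairing`). Contradiction.

References: J. Ax (1964) / R. J. McEliece (1972); MacWilliams–Sloane (1977) Ch. 15 §2; R. O'Donnell (2014) §3.3.  Everything below is proved
from Mathlib and the tree; axioms are the standard three.
-/

set_option linter.dupNamespace false -- D-0017: single-problem summit ⇒ `QuantumAdvantage.QuantumAdvantage` by design

noncomputable section

namespace Summit.QuantumAdvantage.QuantumAdvantage.Theorems.CubicForrelation.NearExactIsExact

open Finset
open Literature.Computability.QuantumComplexity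
open Literature.Computability.QuantumComplexity.BuzetChailloux (bxor zeroVec bxor_bxor_cancel_left bxor_zeroVec zeroVec_bxor bxor_comm
  bxor_self)
open Literature.Computability.QuantumComplexity.DerivativeWalsh (W)

/-- **A type-O cubic on 20 bits never reaches `Φ = 127/128`.**  For cubic `f, g : 𝔽₂²⁰ → 𝔽₂` with `W_g = 128u` and every `u(x)` odd:
`Φ(f,g) < 127/128`.  Finite-slice statement; NOT summit progress. [this work] -/
theorem tt20_typeO_lt (f g : (Fin (10 + 10) → Bool) → Bool) (hf : IsDegLeFun 3 f) (hg : IsDegLeFun 3 g)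
    (u : (Fin (10 + 10) → Bool) → ℤ) (hu : ∀ x, W (fun y => signOf (g y)) x = (2 : ℝ) ^ 7 * (u x : ℝ))
    (hodd : ∀ x, Odd (u x)) : forrelation f g < 127 / 128 := by
  classical
  by_contra hge
  push Not at hge
  -- budget: `τ = u − 8s = ±1` everywhere and `Φ = 127/128`
  have hbud := tp20_budget f g u hu
  have hT : (∑ x, (u x - 8 * sZ (f x)) ^ 2 : ℤ) ≤ 2 ^ 20 := by
    have h' : ((∑ x, (u x - 8 * sZ (f x)) ^ 2 : ℤ) : ℝ) ≤ 2 ^ 20 := by rw [hbud]; nlinarith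
    exact_mod_cast h'
  have hnonneg : ∀ x, 0 ≤ (u x - 8 * sZ (f x)) ^ 2 - (1 : ℤ) := by
    intro x
    have hodd' : Odd (u x - 8 * sZ (f x)) := by
      have h0 := Int.odd_iff.1 (hodd x)
      rcases tp_sZ_cases (f x) with hs | hs <;> rw [hs, Int.odd_iff] <;> omega
    have h0 := Int.odd_iff.1 hodd'
    have : u x - 8 * sZ (f x) ≤ -1 ∨ 1 ≤ u x - 8 * sZ (f x) := by omega
    have := tp_sq_ge (k := 1) (by norm_num) this
    linarith
  have hsum0 : ∑ x, ((u x - 8 * sZ (f x)) ^ 2 - (1 : ℤ)) = 0 := by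
    refine le_antisymm ?_ (sum_nonneg fun x _ => hnonneg x)
    rw [sum_sub_distrib, sum_const, card_univ, Fintype.card_fun, Fintype.card_bool, Fintype.card_fin]
    norm_num
    linarith
  have hτ : ∀ x, u x - 8 * sZ (f x) = 1 ∨ u x - 8 * sZ (f x) = -1 := by
    intro x
    have h := (sum_eq_zero_iff_of_nonneg fun y _ => hnonneg y).1 hsum0 x (mem_univ x)
    have h1 : (u x - 8 * sZ (f x)) * (u x - 8 * sZ (f x)) = 1 := by rw [← pow_two]; linarith
    exact mul_self_eq_one_iff.1 h1
  have hΦeq : forrelation f g = 127 / 128 := by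
    have hT' : (∑ x, (u x - 8 * sZ (f x)) ^ 2 : ℤ) = 2 ^ 20 := by
      have e : ∀ x, (u x - 8 * sZ (f x)) ^ 2 = ((u x - 8 * sZ (f x)) ^ 2 - 1) + 1 := fun x => by ring
      rw [sum_congr rfl fun x _ => e x, sum_add_distrib, hsum0, sum_const, card_univ, Fintype.card_fun, Fintype.card_bool,
        Fintype.card_fin]
      norm_num
    have h : ((∑ x, (u x - 8 * sZ (f x)) ^ 2 : ℤ) : ℝ) = 2 ^ 20 := by exact_mod_cast hT'
    rw [hbud] at h
    linarith
  -- the engine on the whole space: `V₀ = S = 𝔽₂²⁰`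
  set e : (Fin (10 + 10) → Bool) → ℤ := fun x => u x - 8 * sZ (f x) with hedef
  have hS : (univ : Finset (Fin (10 + 10) → Bool)) = (univ : Finset (Fin (10 + 10) → Bool)).image (bxor zeroVec) := by
    ext y
    simp only [mem_univ, mem_image, true_and, true_iff]
    exact ⟨y, zeroVec_bxor y⟩
  have H3 : ∀ x ∈ (univ : Finset (Fin (10 + 10) → Bool)), ∀ a b c : Fin (10 + 10) → Bool, a ∈ (univ : Finset _) → b ∈ (univ : Finset _) →
      c ∈ (univ : Finset _) →
      (4 : ℤ) ∣ ∑ ε : Fin 3 → Bool, e (fun j => x j ^^ decide (Odd #(univ.filter fun i =>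
        ε i && (![a, b, c] : Fin 3 → Fin (10 + 10) → Bool) i j))) := by
    intro x _ a b c _ _ _
    have h4 := fs_flat_sum_dvd (e := 2) g u hg hu x ![a, b, c] (by norm_num)
    obtain ⟨zf, hzf⟩ := sl_sum_sZ_flat f hf x ![a, b, c]
    have hzf' : ∑ ε : Fin 3 → Bool, 8 * sZ (f (fun j => x j ^^ decide (Odd #(univ.filter fun i =>
          ε i && (![a, b, c] : Fin 3 → Fin (10 + 10) → Bool) i j)))) = 4 * (4 * zf) := by
      rw [← mul_sum, hzf]; norm_num; ring
    have h4n : (4 : ℤ) ∣ ∑ ε : Fin 3 → Bool, u (fun j => x j ^^ decide (Odd #(univ.filter fun i =>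
          ε i && (![a, b, c] : Fin 3 → Fin (10 + 10) → Bool) i j))) := by
      have e4 : (2 : ℤ) ^ 2 = 4 := by norm_num
      rw [e4] at h4; exact h4
    simp only [e]
    rw [sum_sub_distrib, hzf']
    exact dvd_sub h4n (Dvd.intro _ rfl)
  have H4 : ∀ x ∈ (univ : Finset (Fin (10 + 10) → Bool)), ∀ a₀ a₁ a₂ a₃ : Fin (10 + 10) → Bool, a₀ ∈ (univ : Finset _) →
      a₁ ∈ (univ : Finset _) → a₂ ∈ (univ : Finset _) → a₃ ∈ (univ : Finset _) →
      (8 : ℤ) ∣ ∑ ε : Fin 4 → Bool, e (fun j => x j ^^ decide (Odd #(univ.filter fun i =>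
        ε i && (![a₀, a₁, a₂, a₃] : Fin 4 → Fin (10 + 10) → Bool) i j))) := by
    intro x _ a₀ a₁ a₂ a₃ _ _ _ _
    have h8 := fs_flat_sum_dvd (e := 3) g u hg hu x ![a₀, a₁, a₂, a₃] (by norm_num)
    obtain ⟨zf, hzf⟩ := sl_sum_sZ_flat f hf x ![a₀, a₁, a₂, a₃]
    have hzf' : ∑ ε : Fin 4 → Bool, 8 * sZ (f (fun j => x j ^^ decide (Odd #(univ.filter fun i =>
          ε i && (![a₀, a₁, a₂, a₃] : Fin 4 → Fin (10 + 10) → Bool) i j)))) = 8 * (4 * zf) := by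
      rw [← mul_sum, hzf]; norm_num
    have h8n : (8 : ℤ) ∣ ∑ ε : Fin 4 → Bool, u (fun j => x j ^^ decide (Odd #(univ.filter fun i =>
          ε i && (![a₀, a₁, a₂, a₃] : Fin 4 → Fin (10 + 10) → Bool) i j))) := by
      have e8 : (2 : ℤ) ^ 3 = 8 := by norm_num
      rw [e8] at h8; exact h8
    simp only [e]
    rw [sum_sub_distrib, hzf']
    exact dvd_sub h8n (Dvd.intro _ rfl)
  have hE := fl1_flat_l1 univ univ zeroVec (mem_univ _) (fun a _ b _ => mem_univ _) hS e (fun x _ => hτ x) H3 H4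
  set A : (Fin (10 + 10) → Bool) → ℝ := fun x => if x ∈ (univ : Finset (Fin (10 + 10) → Bool)) then (e x : ℝ) else 0 with hA
  have hAτ : (fun x => (u x : ℝ) - 8 * signOf (f x)) = A := by
    funext x
    simp only [A, if_pos (mem_univ x), e]
    push_cast
    rw [tp_sZ_cast]
  have hpair := tp20_pairing f g u hu
  rw [hΦeq, hAτ] at hpair
  have h33 : (2 : ℝ) ^ 33 * (1 - 127 / 128) = 2 ^ 26 := by norm_num
  rw [h33] at hpair
  have hge' : (2 : ℝ) ^ 26 ≤ ∑ y, |W A y| := by rw [← hpair]; exact fl1_pairing_le_l1 g (W A)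
  have hsq : ((2 : ℝ) ^ 26) ^ 2 ≤ (∑ y, |W A y|) ^ 2 := pow_le_pow_left₀ (by positivity) hge' 2
  norm_num at hE hsq
  linarith

end Summit.QuantumAdvantage.QuantumAdvantage.Theorems.CubicForrelation.NearExactIsExact

end
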